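import Summits.CriticalPhenomena.CardyFormulaZ2.Theorems.CardyBoundaryCoulombGasRectilinearCardyStubEventIdentityPart6

/-!
# Stub `stub_eventIdentity` of line `excursion-kernel-covariance` (crux `RectilinearCardy`,
# stmt-CriticalPhenomena-5660) — Part 7: starts, terminals and the pairing of the six strand ends
# (layers L3/L8 and S of the design `Lines/excursion-kernel-covariance-eventIdentity-design.md`)

Setting of Part 6: `ι` admissible on `V` with three one-leg sources at cycle indices
`2 ≤ iA < iB < iC < period` and a three-leg sink at `X = d₀.1`, FLAT insertion points (radius
`sinkLegs + 3`), radius-`3` CHARTS at the boundary vertices; `e t = (dsucc V)^[t] d₀`; the six ends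
`e_X, e_v', e_v'', e_A, e_B, e_C` of `ei_strandEnds`. For every `ω ⊆ E`:

* `ei_states`, `ei_rail` — the walk states at the five active darts `0, 1, iA, iB, iC` and the
  radius-`2` frame charts there (`se_active_rail`);
* `ei_ends_cut` — `e_v', e_A, e_C` are CUTS (terminals), `e_X, e_v'', e_B` are not (starts), and the
  turning rule maps `e_v' ↦ e_v''` (Part 27 of the engine line); `ei_ends_tracked`; `ei_ends_distinct`;
* `ei_trackedCut_cases` — **every tracked cut is one of `e_v', e_A, e_C`** (`tc_trackedCuts_are_ends`);
* `ei_start_pred` — each start follows a cut under the turning rule of `cfgOf ω`;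
* `ei_pairing` — hence the strand from each start reaches one of the three terminals
  (`ei_exists_firstCut`, Part 1): the pairing `π`;
* `ei_rainbow_iff` — **`Rainbow ι V ω ↔ Joined e_v'' e_A ∧ Joined e_B e_v' ∧ Joined e_X e_C`**
  (a cut is joined only to itself).

All [folklore]; no new objects.
-/

namespace Summit.CriticalPhenomena.CardyFormulaZ2.Cruxes.RectilinearCardy.ExcursionKernelCovariance

open Finset Literature.Probability.LatticeModels Literature.Probability.LatticeModels.CollarLegModel
open Summit.CriticalPhenomena.CardyFormulaZ2.Cruxes.BoundaryDefectGaussianR.RainbowMonomialsInExcursionKernels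

/-- `Fin 4` bookkeeping: `a + 1 = b + 2 → b = a + 3`. [folklore] -/
theorem ei_fin4_of_add_one_eq_add_two : ∀ a b : Fin 4, a + 1 = b + 2 → b = a + 3 := by decide

section Ends

variable {ι : LegInsertionData} {V : Finset (ℤ × ℤ)} {d₀ : Dart} {iA iB iC : ℕ}
  (hadm : ι.IsAdmissible V)
  (hflat : ∀ x ∈ insert ι.sink ι.source, ∃ dvec : ℤ × ℤ,
      (dvec = (1, 0) ∨ dvec = (-1, 0) ∨ dvec = (0, 1) ∨ dvec = (0, -1)) ∧
      ∀ v : ℤ × ℤ, (v.1 - x.1) ^ 2 + (v.2 - x.2) ^ 2 ≤ ((ι.sinkLegs : ℤ) + 3) ^ 2 →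
        (v ∈ V ↔ 0 ≤ (v.1 - x.1) * dvec.1 + (v.2 - x.2) * dvec.2))
  (hchart : ∀ u ∈ V, ∀ k : Fin 4, u + dir k ∉ V → ∃ (K : Fin 4) (c₁ c₂ : ℤ),
      (∀ v : ℤ × ℤ, |v.1 - u.1| ≤ 3 → |v.2 - u.2| ≤ 3 →
        (v ∈ V ↔ c₂ ≤ v.1 * (dir (K + 1)).1 + v.2 * (dir (K + 1)).2)) ∨
      (∀ v : ℤ × ℤ, |v.1 - u.1| ≤ 3 → |v.2 - u.2| ≤ 3 →
        (v ∈ V ↔ c₁ ≤ v.1 * (dir K).1 + v.2 * (dir K).2 ∧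
          c₂ ≤ v.1 * (dir (K + 1)).1 + v.2 * (dir (K + 1)).2)) ∨
      (∀ v : ℤ × ℤ, |v.1 - u.1| ≤ 3 → |v.2 - u.2| ≤ 3 →
        (v ∈ V ↔ c₂ ≤ v.1 * (dir (K + 1)).1 + v.2 * (dir (K + 1)).2 ∨
          v.1 * (dir K).1 + v.2 * (dir K).2 ≤ c₁)))
  (hv₀ : d₀.1 ∈ V) (ht₀ : dartTip d₀ ∉ V) (hout : outDart V d₀.1 = some d₀)
  (h2 : 2 ≤ iA) (hAB : iA < iB) (hBC : iB < iC) (hCP : iC < period V d₀)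
  (hcA : ((neighbours ((dsucc V)^[iA] d₀).1).filter (fun y ↦ y ∉ V)).card = 1)
  (hcB : ((neighbours ((dsucc V)^[iB] d₀).1).filter (fun y ↦ y ∉ V)).card = 1)
  (hcC : ((neighbours ((dsucc V)^[iC] d₀).1).filter (fun y ↦ y ∉ V)).card = 1)
  (hsrc : ι.source = {((dsucc V)^[iA] d₀).1, ((dsucc V)^[iB] d₀).1, ((dsucc V)^[iC] d₀).1})
  (hlegs : ∀ x ∈ ι.source, ι.legs x = 1) (hsink : ι.sink = d₀.1) (hsl : ι.sinkLegs = 3)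

include hv₀ ht₀ hout h2 hAB hBC hCP hcA hcB hcC hsrc hlegs hsink hsl in
/-- **The walk states at the five active darts.** [folklore] -/
theorem ei_states :
    List.foldl (fun s d => s.step (ι.startAt V d)) ι.init ((cycle V d₀).take 0) = ⟨-3, true, 0, 0⟩ ∧
    List.foldl (fun s d => s.step (ι.startAt V d)) ι.init ((cycle V d₀).take 1) = ⟨-2, false, 2, 1⟩ ∧
    List.foldl (fun s d => s.step (ι.startAt V d)) ι.init ((cycle V d₀).take (1 + 1)) = ⟨0, false, 0, 1⟩ ∧
    List.foldl (fun s d => s.step (ι.startAt V d)) ι.init ((cycle V d₀).take iA) = ⟨0, false, 0, 1⟩ ∧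
    List.foldl (fun s d => s.step (ι.startAt V d)) ι.init ((cycle V d₀).take (iA + 1)) = ⟨-1, true, 0, -1⟩ ∧
    List.foldl (fun s d => s.step (ι.startAt V d)) ι.init ((cycle V d₀).take iB) = ⟨-1, true, 0, -1⟩ ∧
    List.foldl (fun s d => s.step (ι.startAt V d)) ι.init ((cycle V d₀).take (iB + 1)) = ⟨-2, false, 0, -1⟩ ∧
    List.foldl (fun s d => s.step (ι.startAt V d)) ι.init ((cycle V d₀).take iC) = ⟨-2, false, 0, -1⟩ ∧
    List.foldl (fun s d => s.step (ι.startAt V d)) ι.init ((cycle V d₀).take (iC + 1)) = ⟨-3, true, 0, -1⟩ := by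
  obtain ⟨S, hS⟩ : ∃ S : ℕ → WalkState, ∀ t, S t = if t = 0 then ⟨-3, true, 0, 0⟩
      else if t = 1 then ⟨-2, false, 2, 1⟩ else if t ≤ iA then ⟨0, false, 0, 1⟩
      else if t ≤ iB then ⟨-1, true, 0, -1⟩ else if t ≤ iC then ⟨-2, false, 0, -1⟩
      else ⟨-3, true, 0, -1⟩ := ⟨_, fun t => rfl⟩
  have hW := ei_walk_state hv₀ ht₀ hout h2 hAB hBC hCP hcA hcB hcC hsrc hlegs hsink hsl hS
  refine ⟨?_, ?_, ?_, ?_, ?_, ?_, ?_, ?_, ?_⟩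
  · rw [hW 0 (by omega), hS, if_pos rfl]
  · rw [hW 1 (by omega), hS, if_neg (by omega), if_pos rfl]
  · rw [hW (1 + 1) (by omega), hS, if_neg (by omega), if_neg (by omega), if_pos h2]
  · rw [hW iA (by omega), hS, if_neg (by omega), if_neg (by omega), if_pos le_rfl]
  · rw [hW (iA + 1) (by omega), hS, if_neg (by omega), if_neg (by omega), if_neg (by omega),
      if_pos (by omega)]
  · rw [hW iB (by omega), hS, if_neg (by omega), if_neg (by omega), if_neg (by omega), if_pos le_rfl]
  · rw [hW (iB + 1) (by omega), hS, if_neg (by omega), if_neg (by omega), if_neg (by omega),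
      if_neg (by omega), if_pos (by omega)]
  · rw [hW iC (by omega), hS, if_neg (by omega), if_neg (by omega), if_neg (by omega),
      if_neg (by omega), if_pos le_rfl]
  · rw [hW (iC + 1) (by omega), hS, if_neg (by omega), if_neg (by omega), if_neg (by omega),
      if_neg (by omega), if_neg (by omega)]

include hadm hflat hout hsink in
/-- **Frame charts at an active dart** (`se_active_rail`), stated for the cycle dart `e t`: `V`
is the lower half `{u ≤ 0}` of the radius-`2` frames at `(e t).1` and at `(e t).1 - dir (K+1)`
(`K = (e t).2`), and the previous cycle dart is `((e t).1 - dir (K+1), K)`. [folklore] -/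
theorem ei_rail {t : ℕ} (htP : t < period V d₀)
    (hact : (List.foldl (fun s d => s.step (ι.startAt V d)) ι.init ((cycle V d₀).take (t + 1))).level ≠ (List.foldl (fun s d => s.step (ι.startAt V d)) ι.init ((cycle V d₀).take t)).level) :
    ∃ (ht : t < (cycle V d₀).length),
      (∀ s u : ℤ, -2 ≤ s → s ≤ 2 → -2 ≤ u → u ≤ 2 →
        (((dsucc V)^[t] d₀).1 + s • dir (((dsucc V)^[t] d₀).2 + 1) + u • dir ((dsucc V)^[t] d₀).2 ∈ V ↔
          u ≤ 0)) ∧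
      (∀ s u : ℤ, -2 ≤ s → s ≤ 2 → -2 ≤ u → u ≤ 2 →
        (((dsucc V)^[t] d₀).1 - dir (((dsucc V)^[t] d₀).2 + 1) + s • dir (((dsucc V)^[t] d₀).2 + 1) +
            u • dir ((dsucc V)^[t] d₀).2 ∈ V ↔ u ≤ 0)) ∧
      (cycle V d₀)[t]'ht = (((dsucc V)^[t] d₀).1, ((dsucc V)^[t] d₀).2) ∧
      (∀ (_ : 1 ≤ t), (cycle V d₀)[t - 1]'(Nat.lt_of_le_of_lt (Nat.sub_le t 1) ht) =
        (((dsucc V)^[t] d₀).1 - dir (((dsucc V)^[t] d₀).2 + 1), ((dsucc V)^[t] d₀).2)) ∧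
      (t = 0 → (cycle V d₀)[(cycle V d₀).length - 1]'(Nat.sub_lt (Nat.zero_lt_of_lt ht) Nat.one_pos) =
        (((dsucc V)^[t] d₀).1 - dir (((dsucc V)^[t] d₀).2 + 1), ((dsucc V)^[t] d₀).2)) := by
  have hlen : (cycle V d₀).length = period V d₀ := by simp [cycle]
  have ht : t < (cycle V d₀).length := by rw [hlen]; exact htP
  have h0 : outDart V ι.sink = some d₀ := by rw [hsink]; exact hout
  have hst : ∀ t, (fun t => List.foldl (fun s d => s.step (ι.startAt V d)) ι.init ((cycle V d₀).take t)) t = List.foldl (fun s d => s.step (ι.startAt V d)) ι.init ((cycle V d₀).take t) := fun _ => rfl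
  obtain ⟨c, K, hch, hchp, hds, hpred1, hpred0⟩ := se_active_rail ι V hadm h0 hst hflat ht hact
  have hget : (cycle V d₀)[t] = (dsucc V)^[t] d₀ := by simp [cycle]
  rw [hget] at hds
  have hc : ((dsucc V)^[t] d₀).1 = c := by rw [hds]
  have hK : ((dsucc V)^[t] d₀).2 = K := by rw [hds]
  refine ⟨ht, ?_, ?_, ?_, ?_, ?_⟩
  · rw [hc, hK]; exact hch
  · rw [hc, hK]; exact hchp
  · rw [hget, hds]
  · rw [hc, hK]; exact hpred1
  · rw [hc, hK]; exact hpred0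

include hadm hflat hv₀ ht₀ hout h2 hAB hBC hCP hcA hcB hcC hsrc hlegs hsink hsl in
/-- **Which ends are cuts.** The jump finish `e_v'` and the opening-junction ends `e_A`, `e_C` are
cuts; the jump start `e_v''` and the closing-junction ends `e_X`, `e_B` are not; and the turning rule
(of any completed configuration, the jump edge being frozen) maps `e_v'` to `e_v''`. [folklore] -/
theorem ei_ends_cut :
    (ι.model V).IsCut (toSite ((dsucc V)^[1] d₀).1, ((dsucc V)^[1] d₀).2 + 3) ∧ nextCorner ((ι.model V).cfgOf ∅) (toSite ((dsucc V)^[1] d₀).1, ((dsucc V)^[1] d₀).2 + 3) = (toSite ((dsucc V)^[1] d₀).1, ((dsucc V)^[1] d₀).2) ∧ ¬(ι.model V).IsCut (toSite ((dsucc V)^[1] d₀).1, ((dsucc V)^[1] d₀).2) ∧ ¬(ι.model V).IsCut (toSite (dartTip d₀), d₀.2 + 1) ∧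
      (ι.model V).IsCut (toSite (dartTip ((dsucc V)^[iA] d₀)), ((dsucc V)^[iA] d₀).2 + 2) ∧ ¬(ι.model V).IsCut (toSite (dartTip ((dsucc V)^[iB] d₀)), ((dsucc V)^[iB] d₀).2 + 1) ∧ (ι.model V).IsCut (toSite (dartTip ((dsucc V)^[iC] d₀)), ((dsucc V)^[iC] d₀).2 + 2) := by
  obtain ⟨hs0, hs1, hs2, hsA, hsA1, hsB, hsB1, hsC, hsC1⟩ := ei_states hv₀ ht₀ hout h2 hAB hBC hCP hcA hcB hcC hsrc hlegs hsink hsl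
  have h0 : outDart V ι.sink = some d₀ := by rw [hsink]; exact hout
  have hst : ∀ t, (fun t => List.foldl (fun s d => s.step (ι.startAt V d)) ι.init ((cycle V d₀).take t)) t = List.foldl (fun s d => s.step (ι.startAt V d)) ι.init ((cycle V d₀).take t) := fun _ => rfl
  -- the jump at `t = 1`
  obtain ⟨ht1, hch1, hchp1, hds1, hp1, hq1⟩ := ei_rail hadm hflat hout hsink (t := 1) (by omega)
    (by rw [hs2, hs1]; decide)
  have hj := se_isCut_jump_finish ι V hadm h0 hst ht1 hch1 hchp1 hds1 hp1 hq1
    (Or.inl (by rw [hs2, hs1]; decide)) (by rw [hs1]) (by rw [hs2])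
  have hj' := se_not_isCut_jump_start ι V hch1
  -- the closing junction at `t = 0`
  obtain ⟨ht0, hch0, -, hds0, hp0, -⟩ := ei_rail hadm hflat hout hsink (t := 0) (by omega)
    (by rw [hs1, hs0]; decide)
  have hX := se_not_isCut_closing ι V hadm h0 hst ht0 hch0 hds0 hp0 (by rw [hs0])
    (by rw [hs1])
  -- the opening junction at `iA`
  obtain ⟨htA, hchA, -, hdsA, hpA, hqA⟩ := ei_rail hadm hflat hout hsink (t := iA) (by omega)
    (by rw [hsA1, hsA]; decide)
  have hA := se_isCut_opening ι V hadm h0 hst htA hchA hdsA hpA hqA (by rw [hsA])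
  -- the closing junction at `iB`
  obtain ⟨htB, hchB, -, hdsB, hpB, -⟩ := ei_rail hadm hflat hout hsink (t := iB) (by omega)
    (by rw [hsB1, hsB]; decide)
  have hB := se_not_isCut_closing ι V hadm h0 hst htB hchB hdsB hpB (by rw [hsB])
    (by rw [hsB1])
  -- the opening junction at `iC`
  obtain ⟨htC, hchC, -, hdsC, hpC, hqC⟩ := ei_rail hadm hflat hout hsink (t := iC) hCP
    (by rw [hsC1, hsC]; decide)
  have hC := se_isCut_opening ι V hadm h0 hst htC hchC hdsC hpC hqC (by rw [hsC])
  exact ⟨hj.1, hj.2, hj', hX, hA, hB, hC⟩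

include hadm hflat hv₀ ht₀ hout h2 hAB hBC hCP hcA hcB hcC hsrc hlegs hsink hsl in
/-- The six ends are tracked corners. [folklore] -/
theorem ei_ends_tracked :
    (ι.model V).IsTracked (toSite (dartTip d₀), d₀.2 + 1) ∧ (ι.model V).IsTracked (toSite ((dsucc V)^[1] d₀).1, ((dsucc V)^[1] d₀).2 + 3) ∧ (ι.model V).IsTracked (toSite ((dsucc V)^[1] d₀).1, ((dsucc V)^[1] d₀).2) ∧ (ι.model V).IsTracked (toSite (dartTip ((dsucc V)^[iA] d₀)), ((dsucc V)^[iA] d₀).2 + 2) ∧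
      (ι.model V).IsTracked (toSite (dartTip ((dsucc V)^[iB] d₀)), ((dsucc V)^[iB] d₀).2 + 1) ∧ (ι.model V).IsTracked (toSite (dartTip ((dsucc V)^[iC] d₀)), ((dsucc V)^[iC] d₀).2 + 2) := by
  have hE := ei_strandEnds hv₀ ht₀ hout h2 hAB hBC hCP hcA hcB hcC hsrc hlegs hsink hsl
  have htr : ∀ e ∈ ι.strandEnds V, (ι.model V).IsTracked e.1 := fun e he =>
    (s14_strandEnds_pairs ι V hadm hflat e he).1
  refine ⟨htr ((toSite (dartTip d₀), d₀.2 + 1), -3) ?_, htr ((toSite ((dsucc V)^[1] d₀).1, ((dsucc V)^[1] d₀).2 + 3), -2) ?_, htr ((toSite ((dsucc V)^[1] d₀).1, ((dsucc V)^[1] d₀).2), -1) ?_, htr ((toSite (dartTip ((dsucc V)^[iA] d₀)), ((dsucc V)^[iA] d₀).2 + 2), -1) ?_,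
    htr ((toSite (dartTip ((dsucc V)^[iB] d₀)), ((dsucc V)^[iB] d₀).2 + 1), -2) ?_, htr ((toSite (dartTip ((dsucc V)^[iC] d₀)), ((dsucc V)^[iC] d₀).2 + 2), -3) ?_⟩ <;> rw [hE] <;> simp

include hadm hflat hv₀ ht₀ hout h2 hAB hBC hCP hcA hcB hcC hsrc hlegs hsink hsl in
/-- The two ends of each tag are distinct corners. [folklore] -/
theorem ei_ends_distinct : (toSite (dartTip d₀), d₀.2 + 1) ≠ (toSite (dartTip ((dsucc V)^[iC] d₀)), ((dsucc V)^[iC] d₀).2 + 2) ∧ (toSite ((dsucc V)^[1] d₀).1, ((dsucc V)^[1] d₀).2 + 3) ≠ (toSite (dartTip ((dsucc V)^[iB] d₀)), ((dsucc V)^[iB] d₀).2 + 1) ∧ (toSite ((dsucc V)^[1] d₀).1, ((dsucc V)^[1] d₀).2) ≠ (toSite (dartTip ((dsucc V)^[iA] d₀)), ((dsucc V)^[iA] d₀).2 + 2) := by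
  have hext : ∀ i, ((dsucc V)^[i] d₀).1 ∈ V ∧ dartTip ((dsucc V)^[i] d₀) ∉ V :=
    fun i => (s3_dsucc_iterate V i).1 d₀ hv₀ ht₀
  refine ⟨fun h => ?_, fun h => ?_, fun h => ?_⟩
  · -- `e_X = e_C` would put `C` at the outer corner of the frame at `X`
    obtain ⟨hs0, hs1, -⟩ := ei_states hv₀ ht₀ hout h2 hAB hBC hCP hcA hcB hcC hsrc hlegs hsink hsl
    obtain ⟨-, hch0, -⟩ := ei_rail hadm hflat hout hsink (t := 0) (by omega) (by rw [hs1, hs0]; decide)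
    obtain ⟨h1, h2⟩ := Prod.ext_iff.1 h
    simp only at h1 h2
    have hK := ei_fin4_of_add_one_eq_add_two _ _ h2
    rw [toSite_inj, dartTip, dartTip, hK, tp_dir_add_three] at h1
    have hC : ((dsucc V)^[iC] d₀).1 = d₀.1 + (1 : ℤ) • dir (d₀.2 + 1) + (1 : ℤ) • dir d₀.2 := by
      rw [one_smul, one_smul]; linear_combination h1.symm
    have hout' := (hch0 1 1 (by norm_num) (by norm_num) (by norm_num) (by norm_num)).1
    exact absurd (hout' (hC ▸ (hext iC).1)) (by norm_num)
  · have h1 := congrArg Prod.fst h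
    simp only [toSite_inj] at h1
    exact (hext iB).2 (h1 ▸ (hext 1).1)
  · have h1 := congrArg Prod.fst h
    simp only [toSite_inj] at h1
    exact (hext iA).2 (h1 ▸ (hext 1).1)

include hadm hflat hchart hv₀ ht₀ hout h2 hAB hBC hCP hcA hcB hcC hsrc hlegs hsink hsl in
/-- **Every tracked cut is a terminal**: one of `e_v'`, `e_A`, `e_C`. [folklore] -/
theorem ei_trackedCut_cases {c : Site 2 × Fin 4} (htr : (ι.model V).IsTracked c) (hcut : (ι.model V).IsCut c) :
    c = (toSite ((dsucc V)^[1] d₀).1, ((dsucc V)^[1] d₀).2 + 3) ∨ c = (toSite (dartTip ((dsucc V)^[iA] d₀)), ((dsucc V)^[iA] d₀).2 + 2) ∨ c = (toSite (dartTip ((dsucc V)^[iC] d₀)), ((dsucc V)^[iC] d₀).2 + 2) := by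
  obtain ⟨m, hm⟩ := tc_trackedCuts_are_ends ι V hadm hflat hchart c htr hcut
  obtain ⟨-, -, h2n, hXn, -, hBn, -⟩ := ei_ends_cut hadm hflat hv₀ ht₀ hout h2 hAB hBC hCP hcA hcB hcC hsrc hlegs hsink hsl
  rw [ei_strandEnds hv₀ ht₀ hout h2 hAB hBC hCP hcA hcB hcC hsrc hlegs hsink hsl] at hm
  simp only [Finset.mem_insert, Finset.mem_singleton, Prod.mk.injEq] at hm
  rcases hm with ⟨h, -⟩ | ⟨h, -⟩ | ⟨h, -⟩ | ⟨h, -⟩ | ⟨h, -⟩ | ⟨h, -⟩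
  · rw [h] at hcut; exact absurd hcut hXn
  · exact Or.inl h
  · rw [h] at hcut; exact absurd hcut h2n
  · exact Or.inr (Or.inl h)
  · rw [h] at hcut; exact absurd hcut hBn
  · exact Or.inr (Or.inr h)

include hadm hflat hv₀ ht₀ hout h2 hAB hBC hCP hcA hcB hcC hsrc hlegs hsink hsl in
/-- **Each start follows a cut** under the turning rule of `cfgOf ω` (`s14_strandEnds_start`; a cut
has a frozen target, where the rule does not see `ω`). [folklore] -/
theorem ei_start_pred {ω : Finset ((ℤ × ℤ) × Bool)} (hω : ω ⊆ (ι.model V).E) :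
    (∃ q, (ι.model V).IsCut q ∧ nextCorner ((ι.model V).cfgOf ω) q = (toSite (dartTip d₀), d₀.2 + 1)) ∧
    ((ι.model V).IsCut (toSite ((dsucc V)^[1] d₀).1, ((dsucc V)^[1] d₀).2 + 3) ∧ nextCorner ((ι.model V).cfgOf ω) (toSite ((dsucc V)^[1] d₀).1, ((dsucc V)^[1] d₀).2 + 3) = (toSite ((dsucc V)^[1] d₀).1, ((dsucc V)^[1] d₀).2)) ∧
    (∃ q, (ι.model V).IsCut q ∧ nextCorner ((ι.model V).cfgOf ω) q = (toSite (dartTip ((dsucc V)^[iB] d₀)), ((dsucc V)^[iB] d₀).2 + 1)) := by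
  obtain ⟨h1c, h1n, -, hXn, -, hBn, -⟩ := ei_ends_cut hadm hflat hv₀ ht₀ hout h2 hAB hBC hCP hcA hcB hcC hsrc hlegs hsink hsl
  have hE := ei_strandEnds hv₀ ht₀ hout h2 hAB hBC hCP hcA hcB hcC hsrc hlegs hsink hsl
  have hstart : ∀ e ∈ ι.strandEnds V, ¬(ι.model V).IsCut e.1 →
      ∃ q, (ι.model V).IsCut q ∧ nextCorner ((ι.model V).cfgOf ω) q = e.1 := by
    intro e he hnc
    obtain ⟨q, hq, hqe⟩ := s14_strandEnds_start ι V hadm hflat e he hnc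
    exact ⟨q, hq, by rw [nextCorner_cfgOf_eq_of_not_targetsLive hω hq.1]; exact hqe⟩
  refine ⟨hstart ((toSite (dartTip d₀), d₀.2 + 1), -3) (by rw [hE]; simp) hXn, ⟨h1c, ?_⟩, hstart ((toSite (dartTip ((dsucc V)^[iB] d₀)), ((dsucc V)^[iB] d₀).2 + 1), -2) (by rw [hE]; simp) hBn⟩
  rw [nextCorner_cfgOf_eq_of_not_targetsLive hω h1c.1]; exact h1n

include hadm hflat hchart hv₀ ht₀ hout h2 hAB hBC hCP hcA hcB hcC hsrc hlegs hsink hsl in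
/-- **The pairing**: the strand from each start reaches a terminal. [folklore] -/
theorem ei_pairing {ω : Finset ((ℤ × ℤ) × Bool)} (hω : ω ⊆ (ι.model V).E) {s : Site 2 × Fin 4}
    (hs : s = (toSite (dartTip d₀), d₀.2 + 1) ∨ s = (toSite ((dsucc V)^[1] d₀).1, ((dsucc V)^[1] d₀).2) ∨ s = (toSite (dartTip ((dsucc V)^[iB] d₀)), ((dsucc V)^[iB] d₀).2 + 1)) :
    ∃ T, (T = (toSite ((dsucc V)^[1] d₀).1, ((dsucc V)^[1] d₀).2 + 3) ∨ T = (toSite (dartTip ((dsucc V)^[iA] d₀)), ((dsucc V)^[iA] d₀).2 + 2) ∨ T = (toSite (dartTip ((dsucc V)^[iC] d₀)), ((dsucc V)^[iC] d₀).2 + 2)) ∧ (ι.model V).Joined ω s T := by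
  obtain ⟨htrX, -, htr2, -, htrB, -⟩ := ei_ends_tracked hadm hflat hv₀ ht₀ hout h2 hAB hBC hCP hcA hcB hcC hsrc hlegs hsink hsl
  obtain ⟨hpX, ⟨h1c, h1n⟩, hpB⟩ := ei_start_pred hadm hflat hv₀ ht₀ hout h2 hAB hBC hCP hcA hcB hcC hsrc hlegs hsink hsl hω
  have key : ∀ {s q : Site 2 × Fin 4}, (ι.model V).IsTracked s → nextCorner ((ι.model V).cfgOf ω) q = s →
      ((ι.model V).IsCut q ∨ ¬(ι.model V).IsTracked q) →
      ∃ T, (T = (toSite ((dsucc V)^[1] d₀).1, ((dsucc V)^[1] d₀).2 + 3) ∨ T = (toSite (dartTip ((dsucc V)^[iA] d₀)), ((dsucc V)^[iA] d₀).2 + 2) ∨ T = (toSite (dartTip ((dsucc V)^[iC] d₀)), ((dsucc V)^[iC] d₀).2 + 2)) ∧ (ι.model V).Joined ω s T := by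
    intro s q hs hqs hq
    obtain ⟨n, hn, hcut, hbefore, htr⟩ := ei_exists_firstCut hω hs hqs hq
    exact ⟨_, ei_trackedCut_cases hadm hflat hchart hv₀ ht₀ hout h2 hAB hBC hCP hcA hcB hcC hsrc hlegs hsink hsl (htr n le_rfl) hcut,
      ei_joined_firstCut hn hbefore⟩
  rcases hs with rfl | rfl | rfl
  · obtain ⟨q, hq, hqs⟩ := hpX; exact key htrX hqs (Or.inl hq)
  · exact key htr2 h1n (Or.inl h1c)
  · obtain ⟨q, hq, hqs⟩ := hpB; exact key htrB hqs (Or.inl hq)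

include hadm hflat hv₀ ht₀ hout h2 hAB hBC hCP hcA hcB hcC hsrc hlegs hsink hsl in
/-- **Rainbow, read on the pairing**: `ω` is rainbow iff the strand from the jump start `e_v''`
ends at `e_A`, the strand from `e_B` at the jump finish `e_v'`, and the strand from `e_X` at `e_C`.
[cite: BaxterKellandWu1976, §3–§4] -/
theorem ei_rainbow_iff (ω : Finset ((ℤ × ℤ) × Bool)) :
    ι.Rainbow V ω ↔
      (ι.model V).Joined ω (toSite ((dsucc V)^[1] d₀).1, ((dsucc V)^[1] d₀).2) (toSite (dartTip ((dsucc V)^[iA] d₀)), ((dsucc V)^[iA] d₀).2 + 2) ∧ (ι.model V).Joined ω (toSite (dartTip ((dsucc V)^[iB] d₀)), ((dsucc V)^[iB] d₀).2 + 1) (toSite ((dsucc V)^[1] d₀).1, ((dsucc V)^[1] d₀).2 + 3) ∧ (ι.model V).Joined ω (toSite (dartTip d₀), d₀.2 + 1) (toSite (dartTip ((dsucc V)^[iC] d₀)), ((dsucc V)^[iC] d₀).2 + 2) := by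
  have hE := ei_strandEnds hv₀ ht₀ hout h2 hAB hBC hCP hcA hcB hcC hsrc hlegs hsink hsl
  obtain ⟨h1c, -, -, -, hAc, -, hCc⟩ := ei_ends_cut hadm hflat hv₀ ht₀ hout h2 hAB hBC hCP hcA hcB hcC hsrc hlegs hsink hsl
  obtain ⟨hXC, h1B, h2A⟩ := ei_ends_distinct hadm hflat hv₀ ht₀ hout h2 hAB hBC hCP hcA hcB hcC hsrc hlegs hsink hsl
  constructor
  · intro hR
    have hR' : ∀ (s T : Site 2 × Fin 4) (m : ℤ), (s, m) ∈ ι.strandEnds V → (T, m) ∈ ι.strandEnds V →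
        s ≠ T → (ι.model V).IsCut T → (ι.model V).Joined ω s T := by
      intro s T m hs hT hne hT'
      rcases hR (s, m) hs (T, m) hT rfl hne with hj | hj
      · exact hj
      · exact absurd (ei_eq_of_isCut_of_joined hT' hj) hne
    refine ⟨hR' _ _ (-1) ?_ ?_ h2A hAc, hR' _ _ (-2) ?_ ?_ h1B.symm h1c, hR' _ _ (-3) ?_ ?_ hXC hCc⟩ <;>
      rw [hE] <;> simp
  · rintro ⟨hJA, hJB, hJX⟩ ⟨c, m⟩ he ⟨c', m'⟩ he' htag hne
    rw [hE] at he he'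
    simp only [Finset.mem_insert, Finset.mem_singleton, Prod.mk.injEq] at he he'
    simp only [ne_eq] at htag hne ⊢
    rcases he with ⟨rfl, rfl⟩ | ⟨rfl, rfl⟩ | ⟨rfl, rfl⟩ | ⟨rfl, rfl⟩ | ⟨rfl, rfl⟩ | ⟨rfl, rfl⟩ <;>
      rcases he' with ⟨rfl, rfl⟩ | ⟨rfl, rfl⟩ | ⟨rfl, rfl⟩ | ⟨rfl, rfl⟩ | ⟨rfl, rfl⟩ | ⟨rfl, rfl⟩ <;>
      first
        | exact absurd rfl hne
        | exact Or.inl hJA | exact Or.inr hJA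
        | exact Or.inl hJB | exact Or.inr hJB
        | exact Or.inl hJX | exact Or.inr hJX
        | omega

end Ends

/-- **Registered form of `ei_rainbow_iff`** (landing anchor, all hypotheses explicit): for
admissible `(1,1,1; 3)` data with sources at cycle indices `2 ≤ iA < iB < iC` and flat insertion
points, `Rainbow ι V ω ↔ Joined e_v'' e_A ∧ Joined e_B e_v' ∧ Joined e_X e_C`. [cite: BaxterKellandWu1976, §3–§4] -/
theorem ei_rainbow_iff_pairing {ι : LegInsertionData} {V : Finset (ℤ × ℤ)} {d₀ : Dart} {iA iB iC : ℕ}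
    (hadm : ι.IsAdmissible V)
    (hflat : ∀ x ∈ insert ι.sink ι.source, ∃ dvec : ℤ × ℤ,
      (dvec = (1, 0) ∨ dvec = (-1, 0) ∨ dvec = (0, 1) ∨ dvec = (0, -1)) ∧
      ∀ v : ℤ × ℤ, (v.1 - x.1) ^ 2 + (v.2 - x.2) ^ 2 ≤ ((ι.sinkLegs : ℤ) + 3) ^ 2 →
        (v ∈ V ↔ 0 ≤ (v.1 - x.1) * dvec.1 + (v.2 - x.2) * dvec.2))
    (hv₀ : d₀.1 ∈ V) (ht₀ : dartTip d₀ ∉ V) (hout : outDart V d₀.1 = some d₀)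
  (h2 : 2 ≤ iA) (hAB : iA < iB) (hBC : iB < iC) (hCP : iC < period V d₀)
  (hcA : ((neighbours ((dsucc V)^[iA] d₀).1).filter (fun y ↦ y ∉ V)).card = 1)
  (hcB : ((neighbours ((dsucc V)^[iB] d₀).1).filter (fun y ↦ y ∉ V)).card = 1)
  (hcC : ((neighbours ((dsucc V)^[iC] d₀).1).filter (fun y ↦ y ∉ V)).card = 1)
  (hsrc : ι.source = {((dsucc V)^[iA] d₀).1, ((dsucc V)^[iB] d₀).1, ((dsucc V)^[iC] d₀).1})
  (hlegs : ∀ x ∈ ι.source, ι.legs x = 1) (hsink : ι.sink = d₀.1) (hsl : ι.sinkLegs = 3) (ω : Finset ((ℤ × ℤ) × Bool)) :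
    ι.Rainbow V ω ↔
      (ι.model V).Joined ω (toSite ((dsucc V)^[1] d₀).1, ((dsucc V)^[1] d₀).2) (toSite (dartTip ((dsucc V)^[iA] d₀)), ((dsucc V)^[iA] d₀).2 + 2) ∧ (ι.model V).Joined ω (toSite (dartTip ((dsucc V)^[iB] d₀)), ((dsucc V)^[iB] d₀).2 + 1) (toSite ((dsucc V)^[1] d₀).1, ((dsucc V)^[1] d₀).2 + 3) ∧ (ι.model V).Joined ω (toSite (dartTip d₀), d₀.2 + 1) (toSite (dartTip ((dsucc V)^[iC] d₀)), ((dsucc V)^[iC] d₀).2 + 2) :=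
  ei_rainbow_iff hadm hflat hv₀ ht₀ hout h2 hAB hBC hCP hcA hcB hcC hsrc hlegs hsink hsl ω

end Summit.CriticalPhenomena.CardyFormulaZ2.Cruxes.RectilinearCardy.ExcursionKernelCovariance
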